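import Literature.NumberTheory.LFunctions.Zhang2022.DetectorTwoSidedGlued
import Literature.NumberTheory.LFunctions.Zhang2022.DetectorShiftPSDSharp

/-!
# The detector slots are NESTED: glued two-sided slot ⇒ one-sided slot (`Det.GluedFormPSD b → Det.FormDetPSD (shiftRecipe b)`),
# hence `Det.DictShiftPSD b → Det.FormDetPSD (shiftRecipe b)`

Y. Zhang, *Discrete mean estimates and the Landau–Siegel zero*, arXiv:2211.02515v1 [Zhang2022LandauSiegel] —
an unrefereed manuscript under adjudication. **WHAT THIS IS NOT: not a claim about Theorems 1–2 of
arXiv:2211.02515, about Landau–Siegel zeros, about a repaired `Margin232`, or about Parity. The programme SEARCHES and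
TYPES; no claim about Landau–Siegel zeros, Theorems 1–2 of arXiv:2211.02515 or a repaired Margin232 until a kernel
theorem says so.**

Cell landau-siegel §E, bookkeeping over the three shift-detector slots of the class of record (rows 17/55, 56, 57):
the one-sided E-010 slot `Det.FormDetPSD (Det.shiftRecipe b)` (`DetectorMainTermForm`), the no-overlap glued slot
`Det.GluedFormPSD b` and the `H¹` glued slot `Det.DictShiftPSD b` (`RepairDetGlued`, ls-barrier-p6 g3; `DictShiftPSD.gluedFormPSD`
is the implication `H¹`-glued ⇒ no-overlap-glued). This file adds the last link: a one-sided kinked profile `g` (with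
`g 1 = 0`) is the side-1 datum of a glued pair whose side 2 is EMPTY (`v ≡ 0`, split `(t₁, t₂) = (1, 0)`), once `g` is
cut off beyond the unit interval (values on `(1, ∞)` are irrelevant to `Det.FormDet`, which integrates over `[0,1]`):

* `cutProfile g` / `cutDeriv g′` (zero beyond `1`), `kinkedProfile_cut`, `formDet_cut` (`𝔅_R` unchanged: integrands agree
  off the single point `y = 1`), `formDetGlued_zero_side` (`FormDetGlued b u u′ 0 0 = FormDet (shiftRecipe b) u u′`),
* **`Det.GluedFormPSD.formDetPSD : GluedFormPSD b → FormDetPSD (shiftRecipe b)`** and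
  **`Det.DictShiftPSD.formDetPSD_of_ne_zero : DictShiftPSD b → (∀ j, b j ≠ 0) → FormDetPSD (shiftRecipe b)`** —
  so for a sign-admissible `b` the E-010 slot `(gluedFormPSD_of_signAdmissible hb).formDetPSD` also follows from the
  two-sided chain — a second kernel route beside [K6] (same statement as `Det.formDetPSD_shiftRecipe_of_signAdmissible`,
  therefore not restated as a declaration).

0 named facts, 0 sorries; standard axioms. Cell landau-siegel, ls-barrier-p5 g4.
[cite: Zhang2022LandauSiegel, Prop 7.1 p.44 with (7.2), (8.11)–(8.12); §12 (12.6)–(12.8); §18 (18.1)]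
-/

noncomputable section

open Complex Real Set intervalIntegral Filter Topology
open _root_.MeasureTheory
open scoped ComplexConjugate

namespace Literature.NumberTheory.LFunctions.Zhang2022

namespace Det

open Repair

variable {b : Fin 3 → ℝ} {g g' : ℝ → ℂ}

/-! ### Cutting a profile off beyond the unit interval -/

/-- The profile cut off beyond `1`: `g` on `(−∞, 1]`, `0` on `(1, ∞)`. [cite: Zhang2022LandauSiegel, Prop 7.1 p.44 with (7.2)] -/
def cutProfile (g : ℝ → ℂ) (y : ℝ) : ℂ := if y ≤ 1 then g y else 0

/-- The companion cut off at and beyond `1`: `g′` on `(−∞, 1)`, `0` on `[1, ∞)`. [cite: Zhang2022LandauSiegel, Prop 7.1 p.44 with (7.2)] -/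
def cutDeriv (g' : ℝ → ℂ) (y : ℝ) : ℂ := if y < 1 then g' y else 0

/-- On `[0,1]` the cut profile is the profile. [cite: Zhang2022LandauSiegel, Prop 7.1 p.44 with (7.2)] -/
theorem cutProfile_of_le_one {y : ℝ} (hy : y ≤ 1) : cutProfile g y = g y := if_pos hy

/-- Beyond `1` the cut profile vanishes. [cite: Zhang2022LandauSiegel, Prop 7.1 p.44 with (7.2)] -/
theorem cutProfile_of_one_lt {y : ℝ} (hy : 1 < y) : cutProfile g y = 0 := if_neg (not_le.2 hy)

/-- Below `1` the cut companion is the companion. [cite: Zhang2022LandauSiegel, Prop 7.1 p.44 with (7.2)] -/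
theorem cutDeriv_of_lt_one {y : ℝ} (hy : y < 1) : cutDeriv g' y = g' y := if_pos hy

/-- At and beyond `1` the cut companion vanishes. [cite: Zhang2022LandauSiegel, Prop 7.1 p.44 with (7.2)] -/
theorem cutDeriv_of_one_le {y : ℝ} (hy : 1 ≤ y) : cutDeriv g' y = 0 := if_neg (not_lt.2 hy)

/-- Almost every real is `≠ 1`. [folklore] -/
private theorem ae_ne_one : ∀ᵐ y ∂(volume : Measure ℝ), y ≠ (1:ℝ) := by
  have h : (volume : Measure ℝ) {(1:ℝ)} = 0 := measure_singleton _
  rw [ae_iff]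
  simpa only [ne_eq, not_not, setOf_eq_eq_singleton] using h

/-- **The cut pair is a kinked profile** when `g` is (with `g 1 = 0`): continuity and right-derivatives on `[0,1]` are
local, and the companion changes only at the single point `1`. [cite: Zhang2022LandauSiegel, Prop 7.1 p.44 with (7.2)] -/
theorem kinkedProfile_cut (hg : KinkedProfile g g') : KinkedProfile (cutProfile g) (cutDeriv g') where
  cont := hg.cont.congr fun y hy => cutProfile_of_le_one hy.2
  hasDeriv := fun x hx => by
    rw [cutDeriv_of_lt_one hx.2]
    refine (hg.hasDeriv x hx).congr_of_eventuallyEq ?_ (cutProfile_of_le_one hx.2.le)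
    exact Filter.eventuallyEq_of_mem (Ioo_mem_nhdsGT hx.2) fun z hz => cutProfile_of_le_one hz.2.le
  memLp := by
    refine hg.memLp.ae_eq ?_
    filter_upwards [ae_restrict_mem measurableSet_Ioc, ae_restrict_of_ae ae_ne_one] with y hy hy1
    exact (cutDeriv_of_lt_one (lt_of_le_of_ne hy.2 hy1)).symm

/-- The cut pair vanishes on `[1, ∞)` (with its companion), given `g 1 = 0`. [cite: Zhang2022LandauSiegel, Prop 7.1 p.44 with (7.2)] -/
theorem cut_support (hg1 : g 1 = 0) : ∀ y : ℝ, 1 ≤ y → cutProfile g y = 0 ∧ cutDeriv g' y = 0 := by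
  intro y hy
  refine ⟨?_, cutDeriv_of_one_le hy⟩
  rcases hy.lt_or_eq with h | h
  · exact cutProfile_of_one_lt h
  · rw [← h, cutProfile_of_le_one le_rfl, hg1]

/-- **`𝔅_R` does not see the cut**: the formula-I integrands of the cut pair and of `(g, g′)` agree on `[0,1)` (the tail
integral `∫_y^1` lives inside `[0,1]`), i.e. off the single point `y = 1`. [cite: Zhang2022LandauSiegel, Prop 7.1 p.44, (8.11)–(8.12)] -/
theorem mformDet_cut (R : DetRecipe) (g g' : ℝ → ℂ) :
    MformDet R (cutProfile g) (cutDeriv g') (cutProfile g) (cutDeriv g') = MformDet R g g' g g' := by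
  unfold MformDet
  congr 1
  refine Finset.sum_congr rfl fun j _ => ?_
  congr 1
  refine intervalIntegral.integral_congr_ae ?_
  filter_upwards [ae_ne_one] with y hy1 hy
  rw [uIoc_of_le zero_le_one] at hy
  have hy' : y < 1 := lt_of_le_of_ne hy.2 hy1
  have htail : ∫ t in y..(1:ℝ), cutProfile g t = ∫ t in y..(1:ℝ), g t :=
    intervalIntegral.integral_congr fun t ht => by
      rw [uIcc_of_le hy.2] at ht
      exact cutProfile_of_le_one ht.2
  simp only [dipoleIntegrandDet, cutProfile_of_le_one hy.2, cutDeriv_of_lt_one hy', htail]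

/-- `𝔅_R(cut g) = 𝔅_R(g)`. [cite: Zhang2022LandauSiegel, Prop 7.1 p.44, (8.11)–(8.12)] -/
theorem formDet_cut (R : DetRecipe) (g g' : ℝ → ℂ) :
    FormDet R (cutProfile g) (cutDeriv g') = FormDet R g g' := by
  unfold FormDet FormDetPolar
  rw [mformDet_cut]

/-! ### An empty side 2 -/

/-- Formula I on the zero profile vanishes. [cite: Zhang2022LandauSiegel, Prop 7.1 p.44, (8.11)–(8.12)] -/
theorem mformDet_zero (R : DetRecipe) : MformDet R (fun _ => 0) (fun _ => 0) (fun _ => 0) (fun _ => 0) = 0 := by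
  unfold MformDet dipoleIntegrandDet
  simp

/-- `𝔅_R(0) = 0`. [cite: Zhang2022LandauSiegel, Prop 7.1 p.44, (8.11)–(8.12)] -/
theorem formDet_zero (R : DetRecipe) : FormDet R (fun _ => 0) (fun _ => 0) = 0 := by
  unfold FormDet FormDetPolar
  rw [mformDet_zero, map_zero, add_zero, Complex.zero_re]

/-- **A glued pair with EMPTY side 2 is the one-sided form of side 1**: `FormDetGlued b u u′ 0 0 = 𝔅_{R(b)}(u)` (the glue
block `F₀` is bilinear in the two data and the second datum is `0`). [cite: Zhang2022LandauSiegel, §8 (8.2); §18 (18.1)] -/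
theorem formDetGlued_zero_side (b : Fin 3 → ℝ) (u u' : ℝ → ℂ) :
    FormDetGlued b u u' (fun _ => 0) (fun _ => 0) = FormDet (shiftRecipe b) u u' := by
  unfold FormDetGlued FormDetTwoSidedC F0DetC eDet
  rw [formDet_zero]
  simp

/-! ### The hierarchy -/

/-- **Glued slot ⇒ one-sided slot**: `Det.GluedFormPSD b → Det.FormDetPSD (Det.shiftRecipe b)` — a one-sided kinked `g` with
`g 1 = 0`, cut off beyond `1`, paired with an empty side 2 on the split `(1, 0)`, is a member of `Det.GluedSides`, and its
glued form is `𝔅_{R(b)}(g)`. [cite: Zhang2022LandauSiegel, Prop 7.1 p.44 with (7.2); §12 (12.6)–(12.8); §18 (18.1)] -/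
theorem GluedFormPSD.formDetPSD (h : GluedFormPSD b) : FormDetPSD (shiftRecipe b) := by
  intro g g' hg hg1
  have hz : KinkedProfile (fun _ : ℝ => (0:ℂ)) (fun _ => 0) :=
    ⟨continuousOn_const, fun x _ => (hasDerivAt_const x (0:ℂ)).hasDerivWithinAt, memLp_const 0⟩
  have hs : GluedSides (cutProfile g) (cutDeriv g') (fun _ => 0) (fun _ => 0) :=
    ⟨kinkedProfile_cut hg, hz, ⟨1, 0, zero_le_one, le_rfl, by norm_num, cut_support hg1, fun _ _ => ⟨rfl, rfl⟩⟩⟩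
  have := h _ _ _ _ hs
  rwa [formDetGlued_zero_side, formDet_cut] at this

/-- **`H¹` glued slot ⇒ one-sided slot** (`b_j ≠ 0`): `Det.DictShiftPSD b → Det.FormDetPSD (Det.shiftRecipe b)`.
[cite: Zhang2022LandauSiegel, §4 (4.1); Prop 7.1 p.44 with (7.2); §18 (18.1)] -/
theorem DictShiftPSD.formDetPSD_of_ne_zero (h : DictShiftPSD b) (hb : ∀ j, b j ≠ 0) : FormDetPSD (shiftRecipe b) :=
  (h.gluedFormPSD hb).formDetPSD

/-! ### The negative side through the hierarchy (appended): where a lower slot FAILS, every higher slot fails -/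

section Negative

variable {b : Fin 3 → ℝ}

/-- Contrapositive of the hierarchy: a failure of the one-sided slot is a failure of the glued slot.
[cite: Zhang2022LandauSiegel, Prop 7.1 p.44 with (7.2); §18 (18.1)] -/
theorem not_gluedFormPSD_of_not_formDetPSD (h : ¬ FormDetPSD (shiftRecipe b)) : ¬ GluedFormPSD b :=
  fun hG => h hG.formDetPSD

/-- … and a failure of the glued slot is a failure of the `H¹` slot (`b_j ≠ 0`).
[cite: Zhang2022LandauSiegel, §4 (4.1); §18 (18.1)] -/
theorem not_dictShiftPSD_of_not_gluedFormPSD (hb : ∀ j, b j ≠ 0) (h : ¬ GluedFormPSD b) : ¬ DictShiftPSD b :=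
  fun hD => h (hD.gluedFormPSD hb)

/-- **The glued slot FAILS when `c₀(b) < 0`** (distinct `b`, `e₂(b) ≥ 0`): ls-barrier-num's one-sided bump witness
(`Det.not_formDetPSD_of_re_sum_shiftW_neg`, `DetectorShiftPSDSharp`) lifted through the hierarchy — so
`Det.gluedFormPSD_of_signAdmissible` is not a costume: its conclusion is false off the sign-admissible box wherever `c₀ < 0`.
[cite: Zhang2022LandauSiegel, §2 Lemma 2.3; Prop 7.1 p.44 with (7.2); §18 (18.1)] -/
theorem not_gluedFormPSD_of_re_sum_shiftW_neg (hb : Function.Injective b)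
    (he2 : 0 ≤ b 0 * b 1 + b 1 * b 2 + b 2 * b 0) (hc : (∑ j : Fin 3, shiftW b j).re < 0) : ¬ GluedFormPSD b :=
  not_gluedFormPSD_of_not_formDetPSD (not_formDetPSD_of_re_sum_shiftW_neg hb he2 hc)

/-- **The glued slot FAILS in case (B) of the sharpness dichotomy** (`c₀(b) > 0` and SOME doubly-clamped `φ` on `[0,1]` with
negative bulk energy): the one-sided witness `g = −φ′` of `Det.not_formDetPSD_of_clampedNegWitness` lifted through the hierarchy.
[cite: Zhang2022LandauSiegel, §2 Lemma 2.3; Prop 7.1 p.44 with (7.2), (8.11)–(8.23)] -/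
theorem not_gluedFormPSD_of_clampedNegWitness (hb : Function.Injective b) (hc : 0 < (∑ j : Fin 3, shiftW b j).re)
    {φ φ' φ'' : ℝ → ℂ} (hφc : ContinuousOn φ (Icc 0 1)) (hφ'c : ContinuousOn φ' (Icc 0 1))
    (hφd : ∀ y ∈ Ioo (0:ℝ) 1, HasDerivWithinAt φ (φ' y) (Ioi y) y)
    (hφ'd : ∀ y ∈ Ioo (0:ℝ) 1, HasDerivWithinAt φ' (φ'' y) (Ioi y) y)
    (hφ''m : MemLp φ'' 2 (volume.restrict (Ioc (0:ℝ) 1)))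
    (h0 : φ 0 = 0) (h1 : φ 1 = 0) (h0' : φ' 0 = 0) (h1' : φ' 1 = 0)
    (hneg : bulkFormOn b 0 1 φ φ' φ'' < 0) : ¬ GluedFormPSD b :=
  not_gluedFormPSD_of_not_formDetPSD
    (not_formDetPSD_of_clampedNegWitness hb hc hφc hφ'c hφd hφ'd hφ''m h0 h1 h0' h1' hneg)

end Negative

end Det

end Literature.NumberTheory.LFunctions.Zhang2022
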